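import Summits.CriticalPhenomena.PercolationContinuityZ3.Theorems.PercNearOneGluingNoHeavyLowerTailSunflowerTBernT2LevCore
import HarnessLib

/-!
# `NoHeavyLowerTail` (crux stmt-CriticalPhenomena-4575), abstract sunflower cubic: T-BERN — (HC) for a sub-dwarf pack PLUS ONE
# NON-LEVERAGED TIGHT PETAL WITH `z > 1`, by affine interpolation

Support file (seat `prim-ineq-prove-1` gen 65; `--supports stmt-CriticalPhenomena-4575`).  No `sorry`, no named facts.
Memo: run/shared/lean/prim/prim-ineq-prove-1/FINDING-REDUCTION-prove1-g65.md §3.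

`hc_pack` (`…SunflowerTBernPack`) proves the h-endgame condition (HC) for the exact state of {hub `(x_P, z_P, w_P)`, tight
sub-dwarf pack} with `gz = γ_D z_P`.  The reduction of `TBern` (memo §1) also needs it when the pack contains ONE tight
non-leveraged petal `r = (w_r, z_r, w_r)` with `1 ≤ z_r ≤ w_r ≤ D z_r` (a "T2 petal below the diagonal"), absorbed exactly like
the sub-dwarfs (`γ_r = λw_r + μz_r ≤ x_r = w_r`), and with `gz = γ_D z_P z_r` (the vv-budget then gives `Y ≥ gz·z_h`).
**`hcT_of_hc`** proves exactly that, again by AFFINE INTERPOLATION: write `w_r = ζ(1+e)`, `z_r = ζ`; along the line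
`t ↦` {hub `(x_P ζ/t, z_P, w_P)`, pack, petal `(t(1+e), t, t(1+e))`} (total x-mass fixed) the state `(A(t), G(t) = tG₀)` and
`gz(t) = t·γ_D z_P` are affine in `t`, and the (HC) quantity is `t·Ψ(t)` with `Ψ` affine; `Ψ(1) ≥ 0` is `hc_pack` for the
sub-dwarf pack `Q ∪ {e}` and the hub `x_P ζ`, and at the root `t* > ζ` of `A(t) − G(t)` one has `Ψ(t*) = (γ_D z_P − μG₀)(ᾱ − t*G₀) ≥ 0`
because the exact state never exceeds `α` of the absorbed x-mass (`packA_le_alpha` + `xstep_le`).  The assembled certificate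
for {hub, pack, `r`, h} families is `domOn_hub_packT_h` (`…SunflowerTBernT2Pack`).
-/

noncomputable section

namespace Summit.CriticalPhenomena.PercolationContinuityZ3.Theorems.SunflowerPartition

namespace SafeCalc

namespace LinkedCurrency

open Finset Polynomial

variable {ι : Type*}

/-- **(HC) with one non-leveraged `z > 1` petal in the pack, from `hc_pack` by affine interpolation.**  Normalised setting of
`hc_pack`; hub `(x_P, z_P, w_P)`; tight sub-dwarf pack `Q` (`0 ≤ ξ_j ≤ D−1`); one more petal `r ∉ Q` with data `ξ_r = e ∈ [0, D−1]`
and `ζ ≥ 1`, meaning `r = (ζ(1+e), ζ, ζ(1+e))` (`γ_r = ζ(1+λe)`, `α_r = 1 + κ(ζ(1+e)−1)`); x-budget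
`κ·x_P·ζ·∏_{Q∪{r}}(1+ξ_j) ≤ K`.  Exact state: `G = γ_P·packG(Q)·γ_r`, `A = G·(α_P/γ_P − packS(Q) − (γ_r−α_r)/γ_r)`; `gz = γ_D z_P ζ`.
Then `gz < G → G < A → μ(A−G)(G−gz) ≤ (ᾱ−A)(gz−μG)`. [this work] -/
theorem hcT_of_hc [DecidableEq ι] {κ lam μ D K abar xP zP wP ζ A G : ℝ} (hκ0 : 0 ≤ κ) (hκl : κ ≤ lam)
    (hl1 : lam ≤ 1) (hμ : μ = 1 - lam) (hD : 1 ≤ D) (hK0 : 0 ≤ K) (habar : abar = (1 - κ) + K)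
    (hI : μ * abar = (1 - κ) * (lam * D + μ)) (Q : Finset ι) {r : ι} (hrQ : r ∉ Q) {ξ : ι → ℝ}
    (hξ0 : ∀ j ∈ insert r Q, 0 ≤ ξ j) (hξD : ∀ j ∈ insert r Q, ξ j ≤ D - 1) (hz : 1 ≤ zP) (hw1 : 1 ≤ wP)
    (hwx : wP ≤ xP) (hwD : wP ≤ D * zP) (hζ : 1 ≤ ζ)
    (hbud : κ * (xP * ζ) * ∏ j ∈ insert r Q, (1 + ξ j) ≤ K)
    (hG : G = (lam * wP + μ * zP) * packG lam Q ξ * (ζ * (1 + lam * ξ r)))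
    (hA : A = G * ((1 + κ * (xP - 1)) / (lam * wP + μ * zP) - packS κ lam Q ξ -
      (ζ * (1 + lam * ξ r) - (1 + κ * (ζ * (1 + ξ r) - 1))) / (ζ * (1 + lam * ξ r)))) :
    (lam * D + μ) * zP * ζ < G → G < A →
      μ * (A - G) * (G - (lam * D + μ) * zP * ζ) ≤ (abar - A) * ((lam * D + μ) * zP * ζ - μ * G) := by
  intro hrelG hrelA
  have hl : 0 ≤ lam := hκ0.trans hκl
  have hμ0 : 0 ≤ μ := by rw [hμ]; linarith
  have hxP : 1 ≤ xP := hw1.trans hwx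
  have he0 : 0 ≤ ξ r := hξ0 r (mem_insert_self r Q)
  have heD : ξ r ≤ D - 1 := hξD r (mem_insert_self r Q)
  have hξ0Q : ∀ j ∈ Q, 0 ≤ ξ j := fun j hj => hξ0 j (mem_insert_of_mem hj)
  have hξDQ : ∀ j ∈ Q, ξ j ≤ D - 1 := fun j hj => hξD j (mem_insert_of_mem hj)
  set γD := lam * D + μ with hγDdef
  set γP := lam * wP + μ * zP with hγP
  set g := packG lam Q ξ with hg
  set σ := packS κ lam Q ξ with hσ
  set XQ := ∏ j ∈ Q, (1 + ξ j) with hXQ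
  set e := ξ r with hedef
  set γe := 1 + lam * e with hγe
  set gz₀ := γD * zP with hgz₀
  have hγD1 : 1 ≤ γD := by rw [hγDdef, hμ]; linarith [mul_le_mul_of_nonneg_left hD hl]
  have hg1 : 1 ≤ g := one_le_packG hl Q hξ0Q
  have hg0 : 0 < g := by linarith
  have hσ0 : 0 ≤ σ := packS_nonneg hκl hl Q hξ0Q
  have hXQ1 : 1 ≤ XQ := Pendant.one_le_prod_of_one_le Q fun i hi => by linarith [hξ0Q i hi]
  have hγP1 : 1 ≤ γP := by
    have h1 : lam * 1 ≤ lam * wP := mul_le_mul_of_nonneg_left hw1 hl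
    have h2 : μ * 1 ≤ μ * zP := mul_le_mul_of_nonneg_left hz hμ0
    rw [hγP, hμ] at *; linarith
  have hγP0 : 0 < γP := by linarith
  have hγe1 : 1 ≤ γe := by rw [hγe]; have := mul_nonneg hl he0; linarith
  have hγe0 : 0 < γe := by linarith
  have hζ0 : 0 < ζ := by linarith
  have hgz₀1 : 1 ≤ gz₀ := by rw [hgz₀]; exact one_le_mul_of_one_le_of_one_le hγD1 hz
  -- the comparison state at `t = 1`: hub `x_P ζ`, sub-dwarf pack `insert r Q`
  set G₀ := γP * g * γe with hG₀
  have hGζ : G = ζ * G₀ := by rw [hG, hG₀]; ring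
  have hG₀1 : 1 ≤ G₀ := by
    rw [hG₀]; exact one_le_mul_of_one_le_of_one_le (one_le_mul_of_one_le_of_one_le hγP1 hg1) hγe1
  have hG₀0 : 0 < G₀ := by linarith
  have hpackG' : packG lam (insert r Q) ξ = γe * g := by
    rw [hg, hγe, hedef]; simp only [packG]; rw [prod_insert hrQ]
  have hpackS' : packS κ lam (insert r Q) ξ = (lam - κ) * e / γe + σ := by
    rw [hσ, hγe, hedef]; simp only [packS]; rw [sum_insert hrQ]
  have hprod' : ∏ j ∈ insert r Q, (1 + ξ j) = (1 + e) * XQ := by rw [prod_insert hrQ]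
  set A₁ := g * γe * (1 + κ * (xP * ζ - 1)) - G₀ * σ - γP * g * (γe - (1 + κ * e)) with hA₁
  -- the affine state along the line: A(t) − t G₀ = q − m t
  set q := g * γe * κ * (xP * ζ) + γP * g * (1 - κ) with hq
  set m := G₀ * (1 + σ) + γP * g * γe - γP * g * κ * (1 + e) - g * γe * (1 - κ) with hm
  have hAform : A = g * (ζ * γe) * (1 + κ * (xP - 1)) - G * σ - γP * g * (ζ * γe - (1 + κ * (ζ * (1 + e) - 1))) := by
    rw [hA, hG]
    field_simp
  have hLζ : A - G = q - m * ζ := by rw [hAform, hGζ, hq, hm, hG₀]; ring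
  have hL1 : A₁ - G₀ = q - m * 1 := by rw [hA₁, hq, hm, hG₀]; ring
  -- x-budget in α-form and `A₁ ≤ ᾱ`
  have hαbud : 1 + κ * (xP * ζ * ((1 + e) * XQ) - 1) ≤ abar := by
    have e1 : κ * (xP * ζ * ((1 + e) * XQ) - 1) = κ * (xP * ζ) * ((1 + e) * XQ) - κ := by ring
    rw [habar, e1]; rw [hprod'] at hbud; linarith
  have hxζ1 : 1 ≤ xP * ζ := one_le_mul_of_one_le_of_one_le hxP hζ
  have hA₁abar : A₁ ≤ abar := by
    have h1 := packA_le_alpha hκ0 hκl hl1 (x := xP * ζ) (γP := γP) hxζ1 hγP1 (insert r Q) ξ hξ0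
    rw [hpackG', hpackS', hprod'] at h1
    have e1 : γe * g * (1 + κ * (xP * ζ - 1)) - γP * (γe * g) * ((lam - κ) * e / γe + σ) = A₁ := by
      rw [hA₁, hG₀]; field_simp; ring
    rw [e1] at h1
    exact h1.trans hαbud
  -- regime at t = 1 via the end point `t_end = x_P ζ / w_P`
  set tend := xP * ζ / wP with htend
  have hwP0 : 0 < wP := by linarith
  have htend_ge : ζ ≤ tend := by
    rw [htend, le_div_iff₀ hwP0]
    calc ζ * wP ≤ ζ * xP := mul_le_mul_of_nonneg_left hwx hζ0.le
      _ = xP * ζ := mul_comm _ _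
  have htend1 : 1 ≤ tend := hζ.trans htend_ge
  have hLend : q - m * tend ≤ 0 := by
    -- q − m·tend = tend·gγe(α(w_P) − γ_P) − tend G₀ σ − γ_P g (tend γe − α_r(tend)), all three ≤ 0
    have e1 : q - m * tend = tend * (g * γe) * ((1 + κ * (wP - 1)) - γP) - tend * G₀ * σ -
        γP * g * (tend * γe - (1 + κ * (tend * (1 + e) - 1))) := by
      rw [hq, hm, hG₀, htend]; field_simp; ring
    have hαγ : 1 + κ * (wP - 1) ≤ γP := by
      have h1 := alpha_le_gamma hκl hw1
      have h2 : 1 + lam * (wP - 1) ≤ lam * wP + μ * zP := by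
        have := mul_nonneg hμ0 (sub_nonneg.2 hz); linarith
      exact h1.trans h2
    have hd : 0 ≤ tend * γe - (1 + κ * (tend * (1 + e) - 1)) := by
      -- = (tend−1)(1−κ) + tend·e·(λ−κ)
      have e2 : tend * γe - (1 + κ * (tend * (1 + e) - 1)) = (tend - 1) * (1 - κ) + tend * e * (lam - κ) := by
        rw [hγe]; ring
      rw [e2]
      exact add_nonneg (mul_nonneg (sub_nonneg.2 htend1) (by linarith [hκl.trans hl1]))
        (mul_nonneg (mul_nonneg (by linarith) he0) (sub_nonneg.2 hκl))
    have htend0 : 0 ≤ tend := by linarith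
    rw [e1]
    have h1 : tend * (g * γe) * ((1 + κ * (wP - 1)) - γP) ≤ 0 :=
      mul_nonpos_of_nonneg_of_nonpos (mul_nonneg htend0 (mul_nonneg hg0.le hγe0.le)) (sub_nonpos.2 hαγ)
    have h2 : 0 ≤ tend * G₀ * σ := mul_nonneg (mul_nonneg htend0 hG₀0.le) hσ0
    have h3 : 0 ≤ γP * g * (tend * γe - (1 + κ * (tend * (1 + e) - 1))) := mul_nonneg (mul_nonneg hγP0.le hg0.le) hd
    linarith
  have hLζ_pos : 0 < q - m * ζ := by rw [← hLζ]; linarith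
  have hm0 : 0 < m := by
    have e1 : m * (tend - ζ) = (q - m * ζ) - (q - m * tend) := by ring
    have h1 : 0 < m * (tend - ζ) := by rw [e1]; linarith
    by_contra h
    push Not at h
    have : m * (tend - ζ) ≤ 0 := mul_nonpos_of_nonpos_of_nonneg h (sub_nonneg.2 htend_ge)
    linarith
  have hrel1 : G₀ < A₁ := by
    have : q - m * ζ ≤ q - m * 1 := by
      have := mul_le_mul_of_nonneg_left hζ hm0.le; linarith
    linarith [hL1]
  have hrelG1 : γD * zP < G₀ := by
    -- ζ γD zP < ζ G₀
    have h1 : ζ * (γD * zP) < ζ * G₀ := by rw [← hGζ]; linarith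
    exact lt_of_mul_lt_mul_left h1 hζ0.le
  have hHC := hc_pack hκ0 hκl hl1 hμ hD hK0 habar hI (insert r Q) hξ0 hξD hz hw1
    (hwx.trans (le_mul_of_one_le_right (by linarith) hζ)) hwD hbud
    (show G₀ = (lam * wP + μ * zP) * packG lam (insert r Q) ξ by rw [hG₀, hpackG']; ring)
    (show A₁ = packG lam (insert r Q) ξ * (1 + κ * (xP * ζ - 1)) - G₀ * packS κ lam (insert r Q) ξ by
      rw [hA₁, hpackG', hpackS', hG₀]; field_simp; ring)
    hA₁abar hrelG1 hrel1
  rw [← hγDdef, ← hgz₀] at hHC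
  -- Ψ(1) ≥ 0
  have hΨ1 : 0 ≤ (gz₀ - μ * G₀) * (abar - G₀) - lam * gz₀ * (A₁ - G₀) := by
    have e1 : (gz₀ - μ * G₀) * (abar - G₀) - lam * gz₀ * (A₁ - G₀) =
        (abar - A₁) * (gz₀ - μ * G₀) - μ * (A₁ - G₀) * (G₀ - gz₀) := by rw [hμ]; ring
    rw [e1]; linarith
  -- the root t* of L, and Ψ(t*) ≥ 0
  set ts := q / m with hts
  have hts_ζ : ζ < ts := by rw [hts, lt_div_iff₀ hm0]; linarith only [hLζ_pos]
  have hts1 : 1 < ts := lt_of_le_of_lt hζ hts_ζ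
  have hts0 : 0 < ts := lt_trans zero_lt_one hts1
  have hts_end : ts ≤ tend := by rw [hts, div_le_iff₀ hm0]; linarith only [hLend]
  have h0 : q - m * ts = 0 := by rw [hts, mul_div_cancel₀ _ hm0.ne', sub_self]
  set xs := xP * ζ / ts with hxs
  have hxs1 : 1 ≤ xs := by
    rw [hxs, le_div_iff₀ hts0]
    have h1 : ts * wP ≤ xP * ζ := by rwa [htend, le_div_iff₀ hwP0] at hts_end
    have h2 : ts * 1 ≤ ts * wP := mul_le_mul_of_nonneg_left hw1 hts0.le
    linarith only [h1, h2]
  -- the state at t*: A(t*) = t* G₀, and A(t*) ≤ α(x* · XQ · t*(1+e)) = α(x_P ζ (1+e) XQ) ≤ ᾱ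
  have hAts : g * (ts * γe) * (1 + κ * (xs - 1)) - ts * G₀ * σ -
      γP * g * (ts * γe - (1 + κ * (ts * (1 + e) - 1))) = ts * G₀ := by
    have e1 : g * (ts * γe) * (1 + κ * (xs - 1)) - ts * G₀ * σ -
        γP * g * (ts * γe - (1 + κ * (ts * (1 + e) - 1))) - ts * G₀ = q - m * ts := by
      rw [hxs, hq, hm, hG₀]; field_simp; ring
    rw [h0] at e1; linarith only [e1]
  have hGts : ts * G₀ ≤ abar := by
    have h1 : g * (1 + κ * (xs - 1)) - γP * g * σ ≤ 1 + κ * (xs * XQ - 1) :=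
      packA_le_alpha hκ0 hκl hl1 hxs1 hγP1 Q ξ hξ0Q
    have hX1 : 1 ≤ xs * XQ := one_le_mul_of_one_le_of_one_le hxs1 hXQ1
    have hGQ1 : 1 ≤ γP * g := one_le_mul_of_one_le_of_one_le hγP1 hg1
    have hstep := xstep_le (X := xs * XQ) (x := ts * (1 + e)) (γ := ts * γe) (G := γP * g) hκ0 hX1 hGQ1
      (by
        have e2 : ts * γe - (1 + κ * (ts * (1 + e) - 1)) = (ts - 1) * (1 - κ) + ts * e * (lam - κ) := by
          rw [hγe]; ring
        have : 0 ≤ (ts - 1) * (1 - κ) + ts * e * (lam - κ) :=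
          add_nonneg (mul_nonneg (sub_nonneg.2 hts1.le) (by linarith [hκl.trans hl1]))
            (mul_nonneg (mul_nonneg hts0.le he0) (sub_nonneg.2 hκl))
        linarith)
      (by
        have := mul_le_mul_of_nonneg_left (mul_le_mul_of_nonneg_right hl1 he0) hts0.le
        rw [hγe]; linarith)
    -- A(t*) ≤ ts γe · α(xs XQ) − γP g (ts γe − α_r) ≤ α(xs XQ ts (1+e))
    have h2 : g * (ts * γe) * (1 + κ * (xs - 1)) - ts * G₀ * σ =
        (ts * γe) * (g * (1 + κ * (xs - 1)) - γP * g * σ) := by rw [hG₀]; ring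
    have h3 : (ts * γe) * (g * (1 + κ * (xs - 1)) - γP * g * σ) ≤ (ts * γe) * (1 + κ * (xs * XQ - 1)) :=
      mul_le_mul_of_nonneg_left h1 (mul_nonneg hts0.le hγe0.le)
    have h4 : xs * XQ * (ts * (1 + e)) = xP * ζ * ((1 + e) * XQ) := by
      rw [hxs]; field_simp
    rw [← hAts, h2]
    have h5 : 1 + κ * (xs * XQ * (ts * (1 + e)) - 1) ≤ abar := by rw [h4]; exact hαbud
    linarith only [h3, hstep, h5]
  have hgzμG : 0 ≤ gz₀ - μ * G₀ := by
    have h1 : μ * G₀ ≤ μ * abar := mul_le_mul_of_nonneg_left (hrel1.le.trans hA₁abar) hμ0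
    have h2 : μ * abar ≤ gz₀ := by
      rw [hI, hgz₀]
      calc (1 - κ) * γD ≤ 1 * γD :=
            mul_le_mul_of_nonneg_right (by linarith only [hκ0]) (by linarith only [hγD1])
        _ = γD := one_mul _
        _ ≤ γD * zP := le_mul_of_one_le_right (by linarith only [hγD1]) hz
    linarith only [h1, h2]
  have hΨs : 0 ≤ (gz₀ - μ * G₀) * (abar - ts * G₀) - lam * gz₀ * (q - m * ts) := by
    rw [h0, mul_zero, sub_zero]; exact mul_nonneg hgzμG (sub_nonneg.2 hGts)
  -- Ψ affine with slope sl; Ψ(1), Ψ(t*) ≥ 0, 1 ≤ ζ < t* ⟹ Ψ(ζ) ≥ 0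
  rw [hL1] at hΨ1
  set sl := -(gz₀ - μ * G₀) * G₀ + lam * gz₀ * m with hsl
  have hΨζ : (gz₀ - μ * G₀) * (abar - ζ * G₀) - lam * gz₀ * (q - m * ζ) =
      ((gz₀ - μ * G₀) * (abar - G₀) - lam * gz₀ * (q - m * 1)) + sl * (ζ - 1) := by rw [hsl]; ring
  have hΨts : (gz₀ - μ * G₀) * (abar - ts * G₀) - lam * gz₀ * (q - m * ts) =
      ((gz₀ - μ * G₀) * (abar - G₀) - lam * gz₀ * (q - m * 1)) + sl * (ts - 1) := by rw [hsl]; ring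
  have goal : 0 ≤ (gz₀ - μ * G₀) * (abar - ζ * G₀) - lam * gz₀ * (q - m * ζ) := by
    rcases le_or_gt 0 sl with hsl0 | hsl0
    · rw [hΨζ]
      have := mul_nonneg hsl0 (sub_nonneg.2 hζ)
      linarith only [this, hΨ1]
    · rw [hΨts] at hΨs
      rw [hΨζ]
      have : sl * (ts - 1) ≤ sl * (ζ - 1) :=
        mul_le_mul_of_nonpos_left (sub_le_sub_right hts_ζ.le 1) hsl0.le
      linarith only [this, hΨs]
  -- back to the product form at `t = ζ`: multiply Ψ(ζ) ≥ 0 by ζ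
  rw [← hLζ] at goal
  have hΦ : 0 ≤ ζ * ((gz₀ - μ * G₀) * (abar - ζ * G₀) - lam * gz₀ * (A - G)) := mul_nonneg hζ0.le goal
  have e1 : (abar - A) * (gz₀ * ζ - μ * G) - μ * (A - G) * (G - gz₀ * ζ) =
      ζ * ((gz₀ - μ * G₀) * (abar - ζ * G₀) - lam * gz₀ * (A - G)) := by rw [hGζ, hμ]; ring
  rw [show γD * zP * ζ = gz₀ * ζ by rw [hgz₀]]
  linarith only [e1, hΦ]

end LinkedCurrency

end SafeCalc

end Summit.CriticalPhenomena.PercolationContinuityZ3.Theorems.SunflowerPartition
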